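import Literature.NumberTheory.EllipticCurves.CyclotomicLayerPairingOfFun
import Literature.NumberTheory.EllipticCurves.CyclotomicLayerThetaKummer
import Literature.NumberTheory.EllipticCurves.GreenbergSelmerCofreeReductionPk
import HarnessLib

/-!
# The `ρ`-coefficient layer Tate pairings on Kato classes, `⟨x, Q⟩_{n,p^k} ∈ ℤ/p^k` for `x ∈ H¹(Γ_n, T_ρ)`, `Q ∈ E(ℚ_{n,v})^r`
# (PIN-SPEC-S2-g16 D3, assembled from the landed pieces), and the residue clause that PINS a `ℤ_p`-valued family

Topic `NumberTheory/EllipticCurves`, namespace `Literature.NumberTheory.EllipticCurves.CyclotomicLayer`. Definition typer `bsd-wall-defn-rho`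
(cell `bsd-wall`), item D3 of the pin memo `Summits/BirchSwinnertonDyer/BirchSwinnertonDyer/Cruxes/ResidualThetaCountLowerPureAtTwo/PIN-SPEC-S2-g16.md`
for crux RSL_g (stmt-BirchSwinnertonDyer-22608), in the currency landed by the route lead and this seat:

* D1 (lead, `GreenbergSelmerCofreeReductionPk`): `reduceH1CofreePkTorsion S ρ k U : H¹(U, T_ρ) →+ H¹(U, A_ρ[p^k])`, Kato §13.8's `T → T/p^k ≅ A[p^k]`;
* D2 (lead, `GreenbergSelmerCofreeTorsionGaloisModule`, `CyclotomicLayerPairingOfFun`): `A_ρ[p^k]` as a discrete Galois module and the layer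
  pairing `layerPairingOf ρM N e … κ v n : H¹(Γ_n, M) →+ (H¹(U_n, M|) →+ ℤ/N)` for a pairing DATUM `e : M × M → μ_N` (here `M = A_ρ[p^k]`,
  `e` = a self-duality of `ρ` — Kato §14.9's `T*(1) ⊗ ℚ/ℤ ≅ A_ρ` when `det ρ = ε`; a HYPOTHESIS, never constructed here);
* Θ (this seat, `CyclotomicLayerThetaKummer`): `thetaLayerKummer S ρ k W Θ κ v hΘ n : E(ℚ_{n,v})^r →+ H¹(U_n, A_ρ[p^k]|)`, the Θ-transported
  Kummer classes of layer points for a transport `Θ : A_ρ ≃+ E[p^∞]^r` equivariant at `v` (the crux binder `hΘ`).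

THIS FILE composes them: **`rhoLayerPairingPk … n k : H¹(Γ_n, T_ρ) →+ (E(ℚ_{n,v})^r →+ ℤ/p^k)`**,
`x ↦ (Q ↦ ⟨loc_n(red_{p^k} x), Σ_i Θ⁻¹_* κ_{U_n}(Q_i)⟩_{n,p^k})` — the twin, for the lattice `T_ρ` of a framed representation with
`O_λ`-coefficients, of `CyclotomicLayer.tatePairingPk W κ v n k` (`T = T_pW`, Weil pairings) — and proves the PINNING lemma
`eq_of_forall_toZModPow_eq_rhoLayerPairingPk`: a `ℤ_p`-valued family `pair n : H¹(Γ_n, T_ρ) →+ (E(ℚ_{n,v})^r →+ ℤ_p)` is determined by the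
residues `rhoLayerPairingPk n k` (memo (R1): values in `ℤ_p`, `λ_{ℤ_p} = [F:ℚ_p]·λ_𝒪`), twin of `CyclotomicLayer.eq_of_forall_toZModPow_eq_tatePairingPk`.
So a statement quantified over «every `pair` with these residues» (the route's KZ_g print item) speaks about ONE object.
DEFINITIONS WITH BODIES + PROVED lemmas; no named fact, no instance, no notation; nothing about BSD is claimed.

Also recorded (`rfl`): the two cohomology dialects of the tree agree on `A_ρ[N]` — `discreteTopRep U ↥A_ρ[N] = subgroupRep
(cofreeTorsionGaloisModule S ρ N).toTopRep U` (`discreteTopRep_cofreeTorsionBy_eq`), so `subgroupH1 U ↥A_ρ[N]` (target of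
`reduceH1CofreePkTorsion`, home of the Selmer sets) IS `H1 (cofreeTorsionGaloisModule S ρ N) U` (source of `layerPairingOf`); and
`cofreeTorsionLocalRep S ρ N v = localRepOf (cofreeTorsionGaloisModule S ρ N) v`.

NOT here: the datum `e` (self-duality / `det ρ = ε`), compatibility of the residues along `k` (it holds exactly when the family `ePk` is a
tower, `ePk (k+1)` restricting to `ePk k`), the `ℤ_p`-adic limit `pair` itself, `locd` / `pairSg` / Coleman maps (kernel work of the route).

References: [Kato2004Asterisque] §13.8 (pp. 228–229), §14.9 (p. 239); [Kobayashi2003] (8.23) (p. 18); [PerrinRiou1994Invent] §3.6.1;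
[MilneADT2006] Ch. I §2 Cor. 2.3, §6; [Greenberg1989] §1 p. 98.
-/

noncomputable section

open scoped Classical

namespace Literature.NumberTheory.EllipticCurves

open CategoryTheory Field NumberField IsDedekindDomain _root_.WeierstrassCurve
  Literature.NumberTheory.GaloisRepresentations
  Literature.NumberTheory.EllipticCurves.Kobayashi2003
  Literature.NumberTheory.GaloisCohomology ZpExtension
  Literature.NumberTheory.EllipticCurves.GreenbergSelmer

namespace CyclotomicLayer

section Dialects

variable {p : ℕ} [Fact p.Prime] (S : Set (PadicAlgCl p)) {d : ℕ} (ρ : FramedGaloisRep ℚ (padicCoeffIntegers S) d) (N : ℤ)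

/-- **The two cohomology dialects agree on `A_ρ[N]`**: the `DistribMulAction`-style `discreteTopRep U ↥A_ρ[N]` (whose `H¹` is
`subgroupH1 U ↥A_ρ[N]`, target of `reduceH1CofreePkTorsion` and home of the Selmer sets) is, definitionally, the restriction to `U` of the
`TopRep` of the discrete Galois module `cofreeTorsionGaloisModule S ρ N` (whose `H¹` is `H1 (cofreeTorsionGaloisModule S ρ N) U`, source of
`layerPairingOf`). [cite: SerreGaloisCohomology1997, I §2.2] -/
theorem discreteTopRep_cofreeTorsionBy_eq (U : Subgroup (absoluteGaloisGroup ℚ)) :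
    discreteTopRep U ↥(AddSubgroup.torsionBy (Cofree ρ (padicCoeffField S)) N) =
      subgroupRep (cofreeTorsionGaloisModule S ρ N).toTopRep U :=
  rfl

/-- `subgroupH1 U ↥A_ρ[N] = H1 (cofreeTorsionGaloisModule S ρ N) U` as types (`rfl`). [cite: SerreGaloisCohomology1997, I §2.2] -/
theorem subgroupH1_cofreeTorsionBy_eq (U : Subgroup (absoluteGaloisGroup ℚ)) :
    subgroupH1 U ↥(AddSubgroup.torsionBy (Cofree ρ (padicCoeffField S)) N) = H1 (cofreeTorsionGaloisModule S ρ N) U :=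
  rfl

/-- `cofreeTorsionLocalRep S ρ N v` (file `CyclotomicLayerThetaKummer`) is `localRepOf (cofreeTorsionGaloisModule S ρ N) v`
(file `CyclotomicLayerPairingOfFun`) — `rfl`. [cite: MilneADT2006, Ch. I §2] -/
theorem cofreeTorsionLocalRep_eq_localRepOf (v : HeightOneSpectrum (𝓞 ℚ)) :
    cofreeTorsionLocalRep S ρ N v = localRepOf (cofreeTorsionGaloisModule S ρ N) v :=
  rfl

end Dialects

section Family

variable {p : ℕ} [Fact p.Prime] (S : Set (PadicAlgCl p)) {d : ℕ} (ρ : FramedGaloisRep ℚ (padicCoeffIntegers S) d)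
  (W : WeierstrassCurve ℚ) [W.IsElliptic] {r : ℕ}
  (ePk : ∀ k : ℕ, ↥(AddSubgroup.torsionBy (Cofree ρ (padicCoeffField S)) ((p ^ k : ℕ) : ℤ)) →
    ↥(AddSubgroup.torsionBy (Cofree ρ (padicCoeffField S)) ((p ^ k : ℕ) : ℤ)) → AlgebraicClosure ℚ)
  (hμPk : ∀ k a b, ePk k a b ^ (p ^ k) = 1)
  (hadd₁Pk : ∀ k a₁ a₂ b, ePk k (a₁ + a₂) b = ePk k a₁ b * ePk k a₂ b)
  (hadd₂Pk : ∀ k a b₁ b₂, ePk k a (b₁ + b₂) = ePk k a b₁ * ePk k a b₂)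
  (hgalPk : ∀ k (σ : absoluteGaloisGroup ℚ) (a b : ↥(AddSubgroup.torsionBy (Cofree ρ (padicCoeffField S)) ((p ^ k : ℕ) : ℤ))),
    σ • ePk k a b = ePk k (cofreeTorsionGaloisModule S ρ _ σ a) (cofreeTorsionGaloisModule S ρ _ σ b))
  (Θ : Cofree ρ (padicCoeffField S) ≃+ (Fin r → W.geomPrimaryTorsion p)) (κ : ZpExtension ℚ p)
  (v : HeightOneSpectrum (𝓞 ℚ))
  (hΘ : ∀ (δ : absoluteGaloisGroup (v.adicCompletion ℚ)) (m : Cofree ρ (padicCoeffField S)) (i : Fin r),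
    Θ (resGalOfEmb (closureEmb (K := ℚ) (v.adicCompletion ℚ)) δ • m) i =
      resGalOfEmb (closureEmb (K := ℚ) (v.adicCompletion ℚ)) δ • Θ m i)

/-- **The `ρ`-coefficient layer Tate pairings on Kato classes** (memo D3):
`rhoLayerPairingPk … n k : H¹(Γ_n, T_ρ) →+ (E(ℚ_{n,v})^r →+ ℤ/p^k)`, `x ↦ (Q ↦ ⟨loc_n(red_{p^k} x), thetaLayerKummer Q⟩_{n,p^k})` —
the reduction `T_ρ → A_ρ[p^k]` of the class (`reduceH1CofreePkTorsion`, Kato §13.8), localised to `U_n` and paired, under the cup product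
of the datum `ePk k : A_ρ[p^k] × A_ρ[p^k] → μ_{p^k}` and the local invariant (`layerPairingOf`), with the Θ-transported Kummer classes of the
layer points `Q` (`thetaLayerKummer`). For `T_ρ = T_pW`, `A_ρ = E[p^∞]`, `Θ = id`, `e` = Weil this is `CyclotomicLayer.tatePairingPk`:
Kobayashi's `( , )_n` / Perrin-Riou's layer pairing modulo `p^k`, with `O_λ`-lattice coefficients (Kato §14.9).
[cite: Kobayashi2003, (8.23) (p. 18)] [cite: PerrinRiou1994Invent, §3.6.1] [cite: Kato2004Asterisque, §13.8 (pp. 228–229) and §14.9 (p. 239)] -/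
def rhoLayerPairingPk (n k : ℕ) :
    H1 (FramedGaloisRep.toGaloisRep ρ) (κ.layerSubgroup n) →+
      ((Fin r → localLayerPointsOfEmb κ (closureEmb (K := ℚ) (v.adicCompletion ℚ)) W n) →+ ZMod (p ^ k)) :=
  (AddMonoidHom.compHom.flip (thetaLayerKummer S ρ k W Θ κ v hΘ n)).comp
    ((layerPairingOf (cofreeTorsionGaloisModule S ρ ((p ^ k : ℕ) : ℤ)) (p ^ k) (ePk k) (hμPk k) (hadd₁Pk k) (hadd₂Pk k) (hgalPk k)
        κ v n).comp (reduceH1CofreePkTorsion S ρ k (κ.layerSubgroup n)))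

/-- **Unfolding `rhoLayerPairingPk`**: `⟨x, Q⟩_{n,p^k} = layerPairingH1Of … (loc_n (red_{p^k} x)) (thetaLayerKummer … Q)`.
[cite: Kobayashi2003, (8.23) (p. 18)] -/
theorem rhoLayerPairingPk_apply (n k : ℕ) (x : H1 (FramedGaloisRep.toGaloisRep ρ) (κ.layerSubgroup n))
    (Q : Fin r → localLayerPointsOfEmb κ (closureEmb (K := ℚ) (v.adicCompletion ℚ)) W n) :
    rhoLayerPairingPk S ρ W ePk hμPk hadd₁Pk hadd₂Pk hgalPk Θ κ v hΘ n k x Q =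
      layerPairingH1Of (cofreeTorsionGaloisModule S ρ ((p ^ k : ℕ) : ℤ)) (p ^ k) (ePk k) (hμPk k) (hadd₁Pk k) (hadd₂Pk k) (hgalPk k) κ v n
        (layerLocOf (cofreeTorsionGaloisModule S ρ ((p ^ k : ℕ) : ℤ)) κ v n (reduceH1CofreePkTorsion S ρ k (κ.layerSubgroup n) x))
        (thetaLayerKummer S ρ k W Θ κ v hΘ n Q) :=
  rfl

/-- `rhoLayerPairingPk` expanded by components of `Q`: `⟨x, Q⟩_{n,p^k} = Σ_i ⟨loc_n(red_{p^k} x), (thetaSingle i)_* κ_{U_n}(Q_i)⟩`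
(`thetaLayerKummer_apply` and additivity in the second argument). [cite: Kobayashi2003, (8.23) (p. 18)] -/
theorem rhoLayerPairingPk_apply_eq_sum (n k : ℕ) (x : H1 (FramedGaloisRep.toGaloisRep ρ) (κ.layerSubgroup n))
    (Q : Fin r → localLayerPointsOfEmb κ (closureEmb (K := ℚ) (v.adicCompletion ℚ)) W n) :
    rhoLayerPairingPk S ρ W ePk hμPk hadd₁Pk hadd₂Pk hgalPk Θ κ v hΘ n k x Q =
      ∑ i : Fin r, layerPairingH1Of (cofreeTorsionGaloisModule S ρ ((p ^ k : ℕ) : ℤ)) (p ^ k) (ePk k) (hμPk k) (hadd₁Pk k) (hadd₂Pk k)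
        (hgalPk k) κ v n
        (layerLocOf (cofreeTorsionGaloisModule S ρ ((p ^ k : ℕ) : ℤ)) κ v n (reduceH1CofreePkTorsion S ρ k (κ.layerSubgroup n) x))
        (thetaSingleH1 S ρ k W Θ κ v hΘ i n (layerKummer W (p ^ k) κ v n (Q i))) := by
  rw [rhoLayerPairingPk_apply, thetaLayerKummer_apply, map_sum]

/-- **The residue clause PINS the `ℤ_p`-valued pairing of the layers** (memo (R1)): two families
`pair, pair' : ∀ n, H¹(Γ_n, T_ρ) →+ (E(ℚ_{n,v})^r →+ ℤ_p)` whose residues modulo every `p^k` are `rhoLayerPairingPk n k` coincide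
(`ℤ_p` is `p`-adically separated: `PadicInt.ext_of_toZModPow`) — twin of `CyclotomicLayer.eq_of_forall_toZModPow_eq_tatePairingPk`. So a
statement quantified over «every `pair` with these residues» speaks about ONE object, the `ℤ_p`-valued local Tate pairing of the layers for
`(T_ρ, A_ρ)` through `Θ` and `e`. [folklore] [cite: PerrinRiou1994Invent, §3.6.1] -/
theorem eq_of_forall_toZModPow_eq_rhoLayerPairingPk
    {pair pair' : ∀ n : ℕ, H1 (FramedGaloisRep.toGaloisRep ρ) (κ.layerSubgroup n) →+
      ((Fin r → localLayerPointsOfEmb κ (closureEmb (K := ℚ) (v.adicCompletion ℚ)) W n) →+ ℤ_[p])}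
    (h : ∀ (n k : ℕ) (x : H1 (FramedGaloisRep.toGaloisRep ρ) (κ.layerSubgroup n))
      (Q : Fin r → localLayerPointsOfEmb κ (closureEmb (K := ℚ) (v.adicCompletion ℚ)) W n),
      PadicInt.toZModPow k (pair n x Q) = rhoLayerPairingPk S ρ W ePk hμPk hadd₁Pk hadd₂Pk hgalPk Θ κ v hΘ n k x Q)
    (h' : ∀ (n k : ℕ) (x : H1 (FramedGaloisRep.toGaloisRep ρ) (κ.layerSubgroup n))
      (Q : Fin r → localLayerPointsOfEmb κ (closureEmb (K := ℚ) (v.adicCompletion ℚ)) W n),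
      PadicInt.toZModPow k (pair' n x Q) = rhoLayerPairingPk S ρ W ePk hμPk hadd₁Pk hadd₂Pk hgalPk Θ κ v hΘ n k x Q) :
    pair = pair' := by
  funext n
  refine AddMonoidHom.ext fun x ↦ AddMonoidHom.ext fun Q ↦ ?_
  exact PadicInt.ext_of_toZModPow.mp fun k ↦ (h n k x Q).trans (h' n k x Q).symm

end Family

end CyclotomicLayer

end Literature.NumberTheory.EllipticCurves

end
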